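import Summits.QuantumFields.YangMills.Theorems.UnitScaleTiltProp7OneFormCoerciveHolds
import Summits.QuantumFields.YangMills.Theorems.UnitScaleTiltProp7CoerciveRawSlotOfGaugeFixedLift
import Summits.QuantumFields.YangMills.Theorems.UnitScaleTiltProp7TJL2BoundOfSupRow
import HarnessLib

/-!
# Route `UnitScaleTilt`, crux K1 «MinimiserStabilityRegPr» (stmt-QuantumFields-19200), EX rows `norm_G`∕`norm_H₁` (J-slot) — FILE (T-FAM) T2:
# **THE (γ) LETTER AT PRINT'S J-SLOT `Δ₁ᴾ = Pᵀ(Δ^η + T_J)P`: `Δ_a(Δ₁ᴾ)(U₀)` IS COERCIVE, K-UNIFORMLY, AT EVERY LIFTED PRINTED-REGULAR BACKGROUND, FROM THE SUP ROW OF `T_Jᴾ`**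
# ([Balaban1985BackgroundPropagators] Thm 3.11 «`Δ_a`, `G` are positive definite» at the slot (3.128), p.421: `‖G‖·‖T_J‖ < 1`; the `hp₁`∕`hPos₁` input of E1∕E2∕E4 and of the J-slot cone)

Cell `ym3-torus` (HUMAN RULING D-0037; rung R3 = SU(2) YM₃ on T³ — NOT d = 4, NOT infinite volume, NOT a mass gap, NOT Clay).  Width seat `ym3-torus-px12` (gen 18; px10 g14 «GO» 2026-08-30
13:51Z).  THEOREMS ONLY (0 `def`, 0 `sorry`, default heartbeats); `--supports stmt-QuantumFields-19200 --as helper`; count-neutral.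

THE MATHEMATICS (every link LANDED).  The LOD line's curved target ✓`Prop7LODTargetExists.hT_exists` and ✓`Prop7GaugeFixedRowDoorOfLODTarget.gaugeFixedRow_of_curvedTarget` give, under
`Lift`, the gauge-fixed slice floor `γLOD·‖A‖² ≤ re⟨A, Δ^η A⟩ + a‖Q_kA‖²` on `{R_S D* A = 0}`; the sup row of `T_Jᴾ` (T1 ✓`Prop7TJRowsFamilyOfH133.tjRows_family_of_h133` conj (T-sup-lin),
constant `ρ′·MT L` LINEAR in the radius) gives the form bound `‖⟨u, T_Jᴾ v⟩‖ ≤ ρ′MT·‖u‖‖v‖` by symmetry (★p1 ✓`Prop7TJL2BoundOfSupRow.tauRow_TJP_of_supRow`); ✓`gaugeFixedFloor_add_of_bound`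
turns the two into the slice floor `γLOD − ρ′MT` at `Δ^η + T_Jᴾ`, and the cap `ρ′ := αc L ≤ γLOD∕(2MT + 1)` makes it `≥ γLOD∕2` — a pure-real CHOICE, no numerics; ★p1 g22
✓`Prop7CoerciveOfGaugeFixedLift.coercive_laplaceA_DeltaOneP_of_gaugeFixed_of_lift` ((3.118) gauge decomposition + the gradient floor `½` on `N_S` under Lift) then gives
`(min (γLOD∕2) ½ ∕ 2)·‖x‖² ≤ re⟨x, Δ_a(Δ₁ᴾ(T_Jᴾ))(U₀) x⟩` for ALL `x`, and ✓`posOnto_of_coercive` ∕ ✓`norm_GT_le_of_coercive` give the class `PosOnto` and `‖G₁‖ ≤ γ⁻¹`.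

WHAT IS PROVED (ns `Summit.QuantumFields.YangMills.Theorems.Prop7CoerciveDeltaOnePJOfTJSupRow`).
* ★★★ `hco_DeltaOnePJ_exists_of_tjSupLin` — for `c₀ cB`, a window `0 < a₀ ≤ a₁`, and the sup-row family of `T_Jᴾ` linear in the radius (T1's conj (T-sup-lin) VERBATIM under T1's thread,
  letters `αT MT`): THERE ARE `αc γc : ℕ → ℝ` (cap with the three windows of record, `αc ≤ αT`, `0 < γc L`) such that at every member under `RegPr ρ U₀ → ρ ≤ αc L → Lift → ROOM → a ∈ window`:
  `∀ x, γc L·‖x‖² ≤ re⟪x, laplaceA … a (DeltaOneP … a (TJSlotP … a)) U₀ x⟫` ∧ `PosOnto … a (DeltaOneP … a (TJSlotP … a)) U₀` ∧ `∀ f, ‖GT … a (DeltaOneP … a (TJSlotP … a)) U₀ f‖ ≤ (γc L)⁻¹·‖f‖`.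
* ★★★ `hco_DeltaEtaTJ_exists_of_tjSupLin` — the same three rows at the UN-PROJECTED J-slot `S_J := DeltaEtaSlot + TJSlotP … a` (the slot of S47's rows `hCk`∕`h137kΔ`, CHAIR LOCATE №45;
  the `PosOnto(S_J)` input of the slot-generic cone ✓`Prop7KinvSlotOfCone` ∕ px10's K6-J), floor `γLOD∕2`, via ✓`coercive_laplaceA_add_of_curvedTarget_of_lift`.
* ★★ `hco_DeltaOnePJ_exists_of_tjSupLin'` — the same three rows spelled at `DeltaOnePJ … a` (✓`DeltaOnePJ_def` is `rfl`): the slot of S47's `norm_G`.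
HONEST SCOPE.  An `∃`-assembly over landed theorems; CONDITIONAL on the displayed sup-row family of `T_Jᴾ` (T1 ⟸ h133-family ⟸ px10 K6-h133); nothing of `h133`, `norm_G`, `norm_H₁`, EX
or the crux is proved; no summit is proved by a helper; the Yang–Mills mass gap is NOT proved.

References: T. Bałaban, CMP **99** (1985) 389–434 [Balaban1985BackgroundPropagators] (Thm 3.11 p.416, (3.118)–(3.122) pp.419–420, (3.127)–(3.128) p.421, (3.137) p.423);
CMP **102** (1985) 277–309 [Balaban1985Variational] (Thm 1 p.279, (141)–(142) p.299).
-/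

set_option autoImplicit false

noncomputable section

open scoped InnerProductSpace ComplexConjugate Matrix.Norms.L2Operator BigOperators

namespace Summit.QuantumFields.YangMills.Theorems.Prop7CoerciveDeltaOnePJOfTJSupRow

open Literature.MathematicalPhysics.QuantumFieldTheory.Balaban1983to89
open Literature.MathematicalPhysics.QuantumFieldTheory.Balaban1983to89.T3ContinuumYM3Torus
open Literature.MathematicalPhysics.QuantumFieldTheory.Balaban1983to89.T3Thm1Carrier (Idx)
open T3PrintedRegularMinimiser (RegPr)
open T3PrintedMinimiserExistence (regPr_mono)
open T3SectALandauChart (bgUnits)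
open B15DeterminingSets (embIter)
open B11Eq103H1Complex (BondL2K)
open Summit.QuantumFields.YangMills.Theorems.Prop8Chart (emlIterU)
open Summit.QuantumFields.YangMills.Theorems.Prop7SectET3Transport (periodsT3)
open Summit.QuantumFields.YangMills.Theorems.Prop7SectET3HilbertLetters (W₂ toL2 DstarL2)
open Summit.QuantumFields.YangMills.Theorems.Prop7SectET3GaugeProjector (RS)
open Summit.QuantumFields.YangMills.Theorems.Prop7SectET3WilsonHessian (DeltaEta DeltaEtaSlot DeltaEtaSlot_apply)
open Summit.QuantumFields.YangMills.Theorems.Prop7SectET3CurvedPropagators (Qk laplaceA GT PosOnto)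
open Summit.QuantumFields.YangMills.Theorems.Prop7SectET3DeltaOnePInv (DeltaOneP TJSlotP DeltaOnePJ)
open Summit.QuantumFields.YangMills.Theorems.Prop7LODTargetExists (hT_exists)
open Summit.QuantumFields.YangMills.Theorems.Prop7GaugeFixedRowDoorOfLODTarget (gaugeFixedRow_of_curvedTarget)
open Summit.QuantumFields.YangMills.Theorems.Prop7CoerciveOfGaugeFixedLift (coercive_laplaceA_DeltaOneP_of_gaugeFixed_of_lift)
open Summit.QuantumFields.YangMills.Theorems.Prop7CoerciveRawSlotOfGaugeFixedLift (gaugeFixedFloor_add_of_bound)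
open Summit.QuantumFields.YangMills.Theorems.Prop7TJL2BoundOfSupRow (tauRow_TJP_of_supRow)
open Summit.QuantumFields.YangMills.Theorems.Prop7OneFormCoerciveHolds (coercive_laplaceA_add_of_curvedTarget_of_lift posOnto_of_coercive norm_GT_le_of_coercive)

/-- ★★★ **THE (γ) LETTER AT `Δ₁ᴾ(T_Jᴾ)` FOR ALL MEMBERS, `∃`-PACKAGED, FROM THE SUP ROW OF `T_Jᴾ` LINEAR IN THE RADIUS.**  For positive L-only weights `c₀ cB`, a coupling window `0 < a₀ ≤ a₁`,
and L-only `αT MT` with the sup-row family `hTsup` of `T_Jᴾ_a(U₀)` under the K-storey thread (T1's conj (T-sup-lin) VERBATIM: at radius `0 ≤ ρ′ ≤ αT L` the constant is `ρ′·MT L`), THERE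
ARE `αc γc : ℕ → ℝ` with `0 < αc L`, `10¹²L³αc ≤ 1`, `13·10¹⁴L³αc ≤ 1`, `αc L ≤ αT L`, `0 < γc L` such that for every `L > 1`, member `i`, `RegPr ρ U₀` with `ρ ≤ αc L`, under `Lift`, ROOM and
`a₀(c₀ L∕cB L)ℓ³ ≤ a ≤ a₁(c₀ L∕cB L)ℓ³`: the coercivity row, the class `PosOnto`, and `‖G₁‖ ≤ (γc L)⁻¹` at the slot `DeltaOneP … a (TJSlotP … a)` (`γc := min (γLOD∕2) ½ ∕ 2`,
cap `αc ≤ γLOD∕(2MT+1)` so that `‖T_Jᴾ‖ ≤ γLOD∕2`). [cite: Balaban1985BackgroundPropagators, Thm 3.11 p.416, (3.118)–(3.122) pp.419–420, (3.127)–(3.128) p.421; Balaban1985Variational, Thm 1 p.279] -/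
theorem hco_DeltaOnePJ_exists_of_tjSupLin (c₀ cB : ℕ → ℝ) [hc₀ : ∀ L : ℕ, Fact (0 < c₀ L)] [hcB : ∀ L : ℕ, Fact (0 < cB L)] {a₀ a₁ : ℝ} (ha₀ : 0 < a₀)
    (αT MT : ℕ → ℝ) (hαT : ∀ L : ℕ, 1 < L → 0 < αT L) (hWT12 : ∀ L : ℕ, 1 < L → 10 ^ 12 * (L : ℝ) ^ 3 * αT L ≤ 1) (hMT : ∀ L : ℕ, 1 < L → 0 ≤ MT L)
    (hTsup : ∀ (L : ℕ), 1 < L → ∀ (i : Idx L) (U₀ : GaugeField (i.1.1.P i.1.2.2) 0 (Matrix.specialUnitaryGroup (Fin 2) ℂ)), ∀ ρ : ℝ, RegPr i.1.1 i.1.2.1 i.1.2.2 ρ U₀ → ρ ≤ αT L →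
        (∀ cf : Site (i.1.1.P i.1.2.2) (i.1.2.2 - i.1.2.1) → Matrix (Fin 2) (Fin 2) ℂ,
        (∀ e' : PBond (i.1.1.P i.1.2.2) (i.1.2.2 - i.1.2.1), cf e'.src = ((emlIterU (i.1.2.2 - i.1.2.1) (bgUnits i.1.1 i.1.2.2 U₀) e' : (Matrix (Fin 2) (Fin 2) ℂ)ˣ) : Matrix (Fin 2) (Fin 2) ℂ) * cf e'.tgt *
        (((emlIterU (i.1.2.2 - i.1.2.1) (bgUnits i.1.1 i.1.2.2 U₀) e')⁻¹ : (Matrix (Fin 2) (Fin 2) ℂ)ˣ) : Matrix (Fin 2) (Fin 2) ℂ)) →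
        ∃ l₀ : Site (i.1.1.P i.1.2.2) 0 → Matrix (Fin 2) (Fin 2) ℂ,
        (∀ b' : PBond (i.1.1.P i.1.2.2) 0, l₀ b'.src = ((bgUnits i.1.1 i.1.2.2 U₀ b' : (Matrix (Fin 2) (Fin 2) ℂ)ˣ) : Matrix (Fin 2) (Fin 2) ℂ) * l₀ b'.tgt * (((bgUnits i.1.1 i.1.2.2 U₀ b')⁻¹ : (Matrix (Fin 2) (Fin 2) ℂ)ˣ) : Matrix (Fin 2) (Fin 2) ℂ)) ∧
        ∀ y : Site (i.1.1.P i.1.2.2) (i.1.2.2 - i.1.2.1), l₀ (embIter (i.1.2.2 - i.1.2.1) y) = cf y) →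
      2 * (12 * i.1.1.L ^ (i.1.2.2 - i.1.2.1) + 5) ≤ (i.1.1.P i.1.2.2).sitesPerDir 0 →
      ∀ a : ℝ, a₀ * (c₀ L / cB L) * ((i.1.1.L : ℝ) ^ (i.1.2.2 - i.1.2.1)) ^ 3 ≤ a → a ≤ a₁ * (c₀ L / cB L) * ((i.1.1.L : ℝ) ^ (i.1.2.2 - i.1.2.1)) ^ 3 →
      ∀ ρ' : ℝ, 0 ≤ ρ' → ρ' ≤ αT L → RegPr i.1.1 i.1.2.1 i.1.2.2 ρ' U₀ →
        ∀ (X : PBond (i.1.1.P i.1.2.2) 0 → Matrix (Fin 2) (Fin 2) ℂ) (s : ℝ), (∀ bd, ‖X bd‖ ≤ s) →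
          ∀ bd : PBond (i.1.1.P i.1.2.2) 0, ‖(toL2 i.1.1 i.1.2.2 (c₀ L)).symm (TJSlotP i.1.1 i.1.2.1 i.1.2.2 i.2.2.le (c₀ L) (cB L) a U₀ (toL2 i.1.1 i.1.2.2 (c₀ L) X)) bd‖
            ≤ (ρ' * MT L) * s) :
    ∃ (αc γc : ℕ → ℝ),
      (∀ L : ℕ, 1 < L → 0 < αc L) ∧ (∀ L : ℕ, 1 < L → 10 ^ 12 * (L : ℝ) ^ 3 * αc L ≤ 1) ∧ (∀ L : ℕ, 1 < L → 13 * 10 ^ 14 * (L : ℝ) ^ 3 * αc L ≤ 1) ∧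
      (∀ L : ℕ, 1 < L → αc L ≤ αT L) ∧ (∀ L : ℕ, 1 < L → 0 < γc L) ∧
    ∀ (L : ℕ), 1 < L → ∀ (i : Idx L) (U₀ : GaugeField (i.1.1.P i.1.2.2) 0 (Matrix.specialUnitaryGroup (Fin 2) ℂ)), ∀ ρ : ℝ, RegPr i.1.1 i.1.2.1 i.1.2.2 ρ U₀ → ρ ≤ αc L →
        (∀ cf : Site (i.1.1.P i.1.2.2) (i.1.2.2 - i.1.2.1) → Matrix (Fin 2) (Fin 2) ℂ,
        (∀ e' : PBond (i.1.1.P i.1.2.2) (i.1.2.2 - i.1.2.1), cf e'.src = ((emlIterU (i.1.2.2 - i.1.2.1) (bgUnits i.1.1 i.1.2.2 U₀) e' : (Matrix (Fin 2) (Fin 2) ℂ)ˣ) : Matrix (Fin 2) (Fin 2) ℂ) * cf e'.tgt *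
        (((emlIterU (i.1.2.2 - i.1.2.1) (bgUnits i.1.1 i.1.2.2 U₀) e')⁻¹ : (Matrix (Fin 2) (Fin 2) ℂ)ˣ) : Matrix (Fin 2) (Fin 2) ℂ)) →
        ∃ l₀ : Site (i.1.1.P i.1.2.2) 0 → Matrix (Fin 2) (Fin 2) ℂ,
        (∀ b' : PBond (i.1.1.P i.1.2.2) 0, l₀ b'.src = ((bgUnits i.1.1 i.1.2.2 U₀ b' : (Matrix (Fin 2) (Fin 2) ℂ)ˣ) : Matrix (Fin 2) (Fin 2) ℂ) * l₀ b'.tgt * (((bgUnits i.1.1 i.1.2.2 U₀ b')⁻¹ : (Matrix (Fin 2) (Fin 2) ℂ)ˣ) : Matrix (Fin 2) (Fin 2) ℂ)) ∧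
        ∀ y : Site (i.1.1.P i.1.2.2) (i.1.2.2 - i.1.2.1), l₀ (embIter (i.1.2.2 - i.1.2.1) y) = cf y) →
      2 * (12 * i.1.1.L ^ (i.1.2.2 - i.1.2.1) + 5) ≤ (i.1.1.P i.1.2.2).sitesPerDir 0 →
      ∀ a : ℝ, a₀ * (c₀ L / cB L) * ((i.1.1.L : ℝ) ^ (i.1.2.2 - i.1.2.1)) ^ 3 ≤ a → a ≤ a₁ * (c₀ L / cB L) * ((i.1.1.L : ℝ) ^ (i.1.2.2 - i.1.2.1)) ^ 3 →
      (∀ x : BondL2K ℂ 3 (periodsT3 i.1.1 i.1.2.2) (c₀ L) W₂,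
        γc L * ‖x‖ ^ 2 ≤ RCLike.re ⟪x, laplaceA i.1.1 i.1.2.1 i.1.2.2 i.2.2.le (c₀ L) (cB L) a
          (DeltaOneP i.1.1 i.1.2.1 i.1.2.2 i.2.2.le (c₀ L) (cB L) a (TJSlotP i.1.1 i.1.2.1 i.1.2.2 i.2.2.le (c₀ L) (cB L) a)) U₀ x⟫_ℂ) ∧
      PosOnto i.1.1 i.1.2.1 i.1.2.2 i.2.2.le (c₀ L) (cB L) a (DeltaOneP i.1.1 i.1.2.1 i.1.2.2 i.2.2.le (c₀ L) (cB L) a (TJSlotP i.1.1 i.1.2.1 i.1.2.2 i.2.2.le (c₀ L) (cB L) a)) U₀ ∧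
      (∀ f : BondL2K ℂ 3 (periodsT3 i.1.1 i.1.2.2) (c₀ L) W₂,
        ‖GT i.1.1 i.1.2.1 i.1.2.2 i.2.2.le (c₀ L) (cB L) a (DeltaOneP i.1.1 i.1.2.1 i.1.2.2 i.2.2.le (c₀ L) (cB L) a (TJSlotP i.1.1 i.1.2.1 i.1.2.2 i.2.2.le (c₀ L) (cB L) a)) U₀ f‖
          ≤ (γc L)⁻¹ * ‖f‖) := by
  obtain ⟨αLOD, γLOD, hαL, hWαL, hγL, hT⟩ := hT_exists c₀ cB ha₀
  -- the L-only choices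
  set αc : ℕ → ℝ := fun L => min (min (αLOD L) (αT L)) (min (13 * 10 ^ 14 * (L : ℝ) ^ 3)⁻¹ (γLOD L / (2 * MT L + 1))) with hαc
  set γc : ℕ → ℝ := fun L => min (γLOD L / 2) (1 / 2) / 2 with hγc
  have hαc0 : ∀ L : ℕ, 1 < L → 0 < αc L := fun L hL => by
    have := hαL L hL; have := hαT L hL; have := hγL L hL; have := hMT L hL
    have hL0 : (0 : ℝ) < L := by exact_mod_cast lt_trans zero_lt_one hL
    simp only [hαc]; exact lt_min (lt_min (by assumption) (by assumption)) (lt_min (by positivity) (by positivity))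
  have hcLOD : ∀ L, αc L ≤ αLOD L := fun L => by simp only [hαc]; exact (min_le_left _ _).trans (min_le_left _ _)
  have hcT : ∀ L, αc L ≤ αT L := fun L => by simp only [hαc]; exact (min_le_left _ _).trans (min_le_right _ _)
  have hc13 : ∀ L, αc L ≤ (13 * 10 ^ 14 * (L : ℝ) ^ 3)⁻¹ := fun L => by simp only [hαc]; exact (min_le_right _ _).trans (min_le_left _ _)
  have hcγ : ∀ L, αc L ≤ γLOD L / (2 * MT L + 1) := fun L => by simp only [hαc]; exact (min_le_right _ _).trans (min_le_right _ _)
  have hγc0 : ∀ L : ℕ, 1 < L → 0 < γc L := fun L hL => by have := hγL L hL; simp only [hγc]; positivity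
  have hW13 : ∀ L : ℕ, 1 < L → 13 * 10 ^ 14 * (L : ℝ) ^ 3 * αc L ≤ 1 := fun L hL => by
    have hL0 : (0 : ℝ) < L := by exact_mod_cast lt_trans zero_lt_one hL
    have hpos : (0 : ℝ) < 13 * 10 ^ 14 * (L : ℝ) ^ 3 := by positivity
    calc 13 * 10 ^ 14 * (L : ℝ) ^ 3 * αc L ≤ 13 * 10 ^ 14 * (L : ℝ) ^ 3 * (13 * 10 ^ 14 * (L : ℝ) ^ 3)⁻¹ := mul_le_mul_of_nonneg_left (hc13 L) hpos.le
      _ = 1 := mul_inv_cancel₀ hpos.ne'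
  refine ⟨αc, γc, hαc0, fun L hL => (mul_le_mul_of_nonneg_left (hcT L) (by positivity)).trans (hWT12 L hL), hW13, fun L _ => hcT L, hγc0, ?_⟩
  intro L hL i U₀ ρ hreg hρ hlift hroom a ha₀a ha₁a
  have hFL : (i.1.1.L : ℝ) = (L : ℝ) := by rw [i.2.1]
  have hc₀L : 0 < c₀ L := (hc₀ L).out
  have hcBL : 0 < cB L := (hcB L).out
  have hL0 : (0 : ℝ) < L := by exact_mod_cast lt_trans zero_lt_one hL
  have hαcL := hαc0 L hL
  have hMTL := hMT L hL
  have hγLL := hγL L hL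
  have ha : 0 ≤ a := le_trans (by positivity) ha₀a
  -- windows at the member
  have hWεc : 10 ^ 12 * (i.1.1.L : ℝ) ^ 3 * αc L ≤ 1 := by
    rw [hFL]; exact (mul_le_mul_of_nonneg_left (hcT L) (by positivity)).trans (hWT12 L hL)
  have hWεL : 10 ^ 12 * (i.1.1.L : ℝ) ^ 3 * αLOD L ≤ 1 := by rw [hFL]; exact hWαL L hL
  have hW13ρ : 13 * 10 ^ 14 * (i.1.1.L : ℝ) ^ 3 * ρ ≤ 1 := by
    rw [hFL]; exact (mul_le_mul_of_nonneg_left hρ (by positivity)).trans (hW13 L hL)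
  have hregc : RegPr i.1.1 i.1.2.1 i.1.2.2 (αc L) U₀ := regPr_mono (F := i.1.1) hρ hreg
  have hregL : RegPr i.1.1 i.1.2.1 i.1.2.2 (αLOD L) U₀ := regPr_mono (F := i.1.1) (hρ.trans (hcLOD L)) hreg
  -- the τ-row of `T_Jᴾ` at the cap: `τ = αc·MT ≤ γLOD∕2`
  have hrow := hTsup L hL i U₀ ρ hreg (hρ.trans (hcT L)) hlift hroom a ha₀a ha₁a (αc L) hαcL.le (hcT L) hregc
  have hτ := tauRow_TJP_of_supRow i.1.1 i.2.2.le hαcL hWεc ha U₀ hregc (mul_nonneg hαcL.le hMTL) hrow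
  have hτle : αc L * MT L ≤ γLOD L / 2 := by
    have h1 : αc L * MT L ≤ γLOD L / (2 * MT L + 1) * MT L := mul_le_mul_of_nonneg_right (hcγ L) hMTL
    have h2 : γLOD L / (2 * MT L + 1) * MT L ≤ γLOD L / 2 := by
      rw [div_mul_eq_mul_div, div_le_div_iff₀ (by positivity) (by norm_num)]
      nlinarith
    exact h1.trans h2
  -- the slice floor `γLOD` at `Δ^η` (LOD target, under Lift), coupling raised `a₀t ↦ a`
  have hgf0 : ∀ A : BondL2K ℂ 3 (periodsT3 i.1.1 i.1.2.2) (c₀ L) W₂, RS i.1.1 i.1.2.1 i.1.2.2 i.2.2.le (c₀ L) (cB L) U₀ (DstarL2 i.1.1 i.1.2.1 i.1.2.2 (c₀ L) U₀ A) = 0 →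
      γLOD L * ‖A‖ ^ 2 ≤ RCLike.re ⟪A, DeltaEta i.1.1 i.1.2.1 i.1.2.2 (c₀ L) U₀ A⟫_ℂ + a * ‖Qk i.1.1 i.1.2.1 i.1.2.2 i.2.2.le (c₀ L) (cB L) U₀ A‖ ^ 2 := by
    intro A hA
    have h1 := gaugeFixedRow_of_curvedTarget (F := i.1.1) i.2.2.le (cB L) (hαL L hL) hWεL U₀ hregL (hT L hL i U₀ hregL) hlift A hA
    have h2 : a₀ * (c₀ L / cB L) * ((i.1.1.L : ℝ) ^ (i.1.2.2 - i.1.2.1)) ^ 3 * ‖Qk i.1.1 i.1.2.1 i.1.2.2 i.2.2.le (c₀ L) (cB L) U₀ A‖ ^ 2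
        ≤ a * ‖Qk i.1.1 i.1.2.1 i.1.2.2 i.2.2.le (c₀ L) (cB L) U₀ A‖ ^ 2 := mul_le_mul_of_nonneg_right ha₀a (sq_nonneg _)
    linarith
  -- the slice floor `γLOD − τ ≥ γLOD∕2` at `Δ^η + T_Jᴾ`
  have hgf1 := gaugeFixedFloor_add_of_bound i.1.1 (h := i.2.2.le) (cB := cB L) (a := a)
    (fun U => TJSlotP i.1.1 i.1.2.1 i.1.2.2 i.2.2.le (c₀ L) (cB L) a U) U₀ hτ hgf0
  have hgf : ∀ A : BondL2K ℂ 3 (periodsT3 i.1.1 i.1.2.2) (c₀ L) W₂, RS i.1.1 i.1.2.1 i.1.2.2 i.2.2.le (c₀ L) (cB L) U₀ (DstarL2 i.1.1 i.1.2.1 i.1.2.2 (c₀ L) U₀ A) = 0 →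
      γLOD L / 2 * ‖A‖ ^ 2 ≤ RCLike.re ⟪A, DeltaEta i.1.1 i.1.2.1 i.1.2.2 (c₀ L) U₀ A + TJSlotP i.1.1 i.1.2.1 i.1.2.2 i.2.2.le (c₀ L) (cB L) a U₀ A⟫_ℂ
        + a * ‖Qk i.1.1 i.1.2.1 i.1.2.2 i.2.2.le (c₀ L) (cB L) U₀ A‖ ^ 2 := by
    intro A hA
    have h1 := hgf1 A hA
    have h2 : γLOD L / 2 * ‖A‖ ^ 2 ≤ (γLOD L - αc L * MT L) * ‖A‖ ^ 2 := mul_le_mul_of_nonneg_right (by linarith) (sq_nonneg _)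
    exact h2.trans h1
  -- ★p1 g22's door at `Δ₁ᴾ(T_Jᴾ)`
  have hco := coercive_laplaceA_DeltaOneP_of_gaugeFixed_of_lift i.1.1 i.2.2.le hαcL hWεc ha
    (TJSlotP i.1.1 i.1.2.1 i.1.2.2 i.2.2.le (c₀ L) (cB L) a) U₀ hregc hlift (by positivity : (0 : ℝ) ≤ γLOD L / 2) hgf
  have hco' : ∀ x : BondL2K ℂ 3 (periodsT3 i.1.1 i.1.2.2) (c₀ L) W₂,
      γc L * ‖x‖ ^ 2 ≤ RCLike.re ⟪x, laplaceA i.1.1 i.1.2.1 i.1.2.2 i.2.2.le (c₀ L) (cB L) a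
        (DeltaOneP i.1.1 i.1.2.1 i.1.2.2 i.2.2.le (c₀ L) (cB L) a (TJSlotP i.1.1 i.1.2.1 i.1.2.2 i.2.2.le (c₀ L) (cB L) a)) U₀ x⟫_ℂ := fun x => by
    simp only [hγc]; exact hco x
  exact ⟨hco', posOnto_of_coercive i.2.2.le (cB L) i.2.2 hreg hW13ρ (hγc0 L hL) _ hco', norm_GT_le_of_coercive i.2.2.le (cB L) i.2.2 hreg hW13ρ (hγc0 L hL) _ hco'⟩

/-- ★★★ **THE (γ) LETTER AT THE UN-PROJECTED J-SLOT `S_J := Δ^η + T_Jᴾ` (the slot of S47's rows `hCk`∕`h137kΔ`; CHAIR LOCATE №45) FOR ALL MEMBERS, `∃`-PACKAGED, FROM THE SAME SUP ROW.**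
Same letters as `hco_DeltaOnePJ_exists_of_tjSupLin`; conclusion at the slot `DeltaEtaSlot … (c₀ L) + TJSlotP … a` with floor `γr := γLOD∕2`: ✓`coercive_laplaceA_add_of_curvedTarget_of_lift` (floor `γ − τ` for
`Δx U₀ v = Δ^η v + T v`, `re⟪v, T v⟫ ≥ −τ‖v‖²`) with `τ := αc·MT ≤ γLOD∕2` from the τ-row; then `PosOnto` and `‖G_S‖ ≤ γr⁻¹`. [cite: Balaban1985BackgroundPropagators, Thm 3.11 p.416, (3.26) p.395, (3.127)–(3.128) p.421; Balaban1985Variational, (110) p.294] -/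
theorem hco_DeltaEtaTJ_exists_of_tjSupLin (c₀ cB : ℕ → ℝ) [hc₀ : ∀ L : ℕ, Fact (0 < c₀ L)] [hcB : ∀ L : ℕ, Fact (0 < cB L)] {a₀ a₁ : ℝ} (ha₀ : 0 < a₀)
    (αT MT : ℕ → ℝ) (hαT : ∀ L : ℕ, 1 < L → 0 < αT L) (hWT12 : ∀ L : ℕ, 1 < L → 10 ^ 12 * (L : ℝ) ^ 3 * αT L ≤ 1) (hMT : ∀ L : ℕ, 1 < L → 0 ≤ MT L)
    (hTsup : ∀ (L : ℕ), 1 < L → ∀ (i : Idx L) (U₀ : GaugeField (i.1.1.P i.1.2.2) 0 (Matrix.specialUnitaryGroup (Fin 2) ℂ)), ∀ ρ : ℝ, RegPr i.1.1 i.1.2.1 i.1.2.2 ρ U₀ → ρ ≤ αT L →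
        (∀ cf : Site (i.1.1.P i.1.2.2) (i.1.2.2 - i.1.2.1) → Matrix (Fin 2) (Fin 2) ℂ,
        (∀ e' : PBond (i.1.1.P i.1.2.2) (i.1.2.2 - i.1.2.1), cf e'.src = ((emlIterU (i.1.2.2 - i.1.2.1) (bgUnits i.1.1 i.1.2.2 U₀) e' : (Matrix (Fin 2) (Fin 2) ℂ)ˣ) : Matrix (Fin 2) (Fin 2) ℂ) * cf e'.tgt *
        (((emlIterU (i.1.2.2 - i.1.2.1) (bgUnits i.1.1 i.1.2.2 U₀) e')⁻¹ : (Matrix (Fin 2) (Fin 2) ℂ)ˣ) : Matrix (Fin 2) (Fin 2) ℂ)) →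
        ∃ l₀ : Site (i.1.1.P i.1.2.2) 0 → Matrix (Fin 2) (Fin 2) ℂ,
        (∀ b' : PBond (i.1.1.P i.1.2.2) 0, l₀ b'.src = ((bgUnits i.1.1 i.1.2.2 U₀ b' : (Matrix (Fin 2) (Fin 2) ℂ)ˣ) : Matrix (Fin 2) (Fin 2) ℂ) * l₀ b'.tgt * (((bgUnits i.1.1 i.1.2.2 U₀ b')⁻¹ : (Matrix (Fin 2) (Fin 2) ℂ)ˣ) : Matrix (Fin 2) (Fin 2) ℂ)) ∧
        ∀ y : Site (i.1.1.P i.1.2.2) (i.1.2.2 - i.1.2.1), l₀ (embIter (i.1.2.2 - i.1.2.1) y) = cf y) →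
      2 * (12 * i.1.1.L ^ (i.1.2.2 - i.1.2.1) + 5) ≤ (i.1.1.P i.1.2.2).sitesPerDir 0 →
      ∀ a : ℝ, a₀ * (c₀ L / cB L) * ((i.1.1.L : ℝ) ^ (i.1.2.2 - i.1.2.1)) ^ 3 ≤ a → a ≤ a₁ * (c₀ L / cB L) * ((i.1.1.L : ℝ) ^ (i.1.2.2 - i.1.2.1)) ^ 3 →
      ∀ ρ' : ℝ, 0 ≤ ρ' → ρ' ≤ αT L → RegPr i.1.1 i.1.2.1 i.1.2.2 ρ' U₀ →
        ∀ (X : PBond (i.1.1.P i.1.2.2) 0 → Matrix (Fin 2) (Fin 2) ℂ) (s : ℝ), (∀ bd, ‖X bd‖ ≤ s) →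
          ∀ bd : PBond (i.1.1.P i.1.2.2) 0, ‖(toL2 i.1.1 i.1.2.2 (c₀ L)).symm (TJSlotP i.1.1 i.1.2.1 i.1.2.2 i.2.2.le (c₀ L) (cB L) a U₀ (toL2 i.1.1 i.1.2.2 (c₀ L) X)) bd‖
            ≤ (ρ' * MT L) * s) :
    ∃ (αc γr : ℕ → ℝ),
      (∀ L : ℕ, 1 < L → 0 < αc L) ∧ (∀ L : ℕ, 1 < L → 10 ^ 12 * (L : ℝ) ^ 3 * αc L ≤ 1) ∧ (∀ L : ℕ, 1 < L → 13 * 10 ^ 14 * (L : ℝ) ^ 3 * αc L ≤ 1) ∧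
      (∀ L : ℕ, 1 < L → αc L ≤ αT L) ∧ (∀ L : ℕ, 1 < L → 0 < γr L) ∧
    ∀ (L : ℕ), 1 < L → ∀ (i : Idx L) (U₀ : GaugeField (i.1.1.P i.1.2.2) 0 (Matrix.specialUnitaryGroup (Fin 2) ℂ)), ∀ ρ : ℝ, RegPr i.1.1 i.1.2.1 i.1.2.2 ρ U₀ → ρ ≤ αc L →
        (∀ cf : Site (i.1.1.P i.1.2.2) (i.1.2.2 - i.1.2.1) → Matrix (Fin 2) (Fin 2) ℂ,
        (∀ e' : PBond (i.1.1.P i.1.2.2) (i.1.2.2 - i.1.2.1), cf e'.src = ((emlIterU (i.1.2.2 - i.1.2.1) (bgUnits i.1.1 i.1.2.2 U₀) e' : (Matrix (Fin 2) (Fin 2) ℂ)ˣ) : Matrix (Fin 2) (Fin 2) ℂ) * cf e'.tgt *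
        (((emlIterU (i.1.2.2 - i.1.2.1) (bgUnits i.1.1 i.1.2.2 U₀) e')⁻¹ : (Matrix (Fin 2) (Fin 2) ℂ)ˣ) : Matrix (Fin 2) (Fin 2) ℂ)) →
        ∃ l₀ : Site (i.1.1.P i.1.2.2) 0 → Matrix (Fin 2) (Fin 2) ℂ,
        (∀ b' : PBond (i.1.1.P i.1.2.2) 0, l₀ b'.src = ((bgUnits i.1.1 i.1.2.2 U₀ b' : (Matrix (Fin 2) (Fin 2) ℂ)ˣ) : Matrix (Fin 2) (Fin 2) ℂ) * l₀ b'.tgt * (((bgUnits i.1.1 i.1.2.2 U₀ b')⁻¹ : (Matrix (Fin 2) (Fin 2) ℂ)ˣ) : Matrix (Fin 2) (Fin 2) ℂ)) ∧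
        ∀ y : Site (i.1.1.P i.1.2.2) (i.1.2.2 - i.1.2.1), l₀ (embIter (i.1.2.2 - i.1.2.1) y) = cf y) →
      2 * (12 * i.1.1.L ^ (i.1.2.2 - i.1.2.1) + 5) ≤ (i.1.1.P i.1.2.2).sitesPerDir 0 →
      ∀ a : ℝ, a₀ * (c₀ L / cB L) * ((i.1.1.L : ℝ) ^ (i.1.2.2 - i.1.2.1)) ^ 3 ≤ a → a ≤ a₁ * (c₀ L / cB L) * ((i.1.1.L : ℝ) ^ (i.1.2.2 - i.1.2.1)) ^ 3 →
      (∀ x : BondL2K ℂ 3 (periodsT3 i.1.1 i.1.2.2) (c₀ L) W₂,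
        γr L * ‖x‖ ^ 2 ≤ RCLike.re ⟪x, laplaceA i.1.1 i.1.2.1 i.1.2.2 i.2.2.le (c₀ L) (cB L) a
          (DeltaEtaSlot i.1.1 i.1.2.1 i.1.2.2 (c₀ L) + TJSlotP i.1.1 i.1.2.1 i.1.2.2 i.2.2.le (c₀ L) (cB L) a) U₀ x⟫_ℂ) ∧
      PosOnto i.1.1 i.1.2.1 i.1.2.2 i.2.2.le (c₀ L) (cB L) a (DeltaEtaSlot i.1.1 i.1.2.1 i.1.2.2 (c₀ L) + TJSlotP i.1.1 i.1.2.1 i.1.2.2 i.2.2.le (c₀ L) (cB L) a) U₀ ∧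
      (∀ f : BondL2K ℂ 3 (periodsT3 i.1.1 i.1.2.2) (c₀ L) W₂,
        ‖GT i.1.1 i.1.2.1 i.1.2.2 i.2.2.le (c₀ L) (cB L) a (DeltaEtaSlot i.1.1 i.1.2.1 i.1.2.2 (c₀ L) + TJSlotP i.1.1 i.1.2.1 i.1.2.2 i.2.2.le (c₀ L) (cB L) a) U₀ f‖
          ≤ (γr L)⁻¹ * ‖f‖) := by
  obtain ⟨αLOD, γLOD, hαL, hWαL, hγL, hT⟩ := hT_exists c₀ cB ha₀
  set αc : ℕ → ℝ := fun L => min (min (αLOD L) (αT L)) (min (13 * 10 ^ 14 * (L : ℝ) ^ 3)⁻¹ (γLOD L / (2 * MT L + 1))) with hαc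
  have hαc0 : ∀ L : ℕ, 1 < L → 0 < αc L := fun L hL => by
    have := hαL L hL; have := hαT L hL; have := hγL L hL; have := hMT L hL
    have hL0 : (0 : ℝ) < L := by exact_mod_cast lt_trans zero_lt_one hL
    simp only [hαc]; exact lt_min (lt_min (by assumption) (by assumption)) (lt_min (by positivity) (by positivity))
  have hcLOD : ∀ L, αc L ≤ αLOD L := fun L => by simp only [hαc]; exact (min_le_left _ _).trans (min_le_left _ _)
  have hcT : ∀ L, αc L ≤ αT L := fun L => by simp only [hαc]; exact (min_le_left _ _).trans (min_le_right _ _)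
  have hc13 : ∀ L, αc L ≤ (13 * 10 ^ 14 * (L : ℝ) ^ 3)⁻¹ := fun L => by simp only [hαc]; exact (min_le_right _ _).trans (min_le_left _ _)
  have hcγ : ∀ L, αc L ≤ γLOD L / (2 * MT L + 1) := fun L => by simp only [hαc]; exact (min_le_right _ _).trans (min_le_right _ _)
  have hW13 : ∀ L : ℕ, 1 < L → 13 * 10 ^ 14 * (L : ℝ) ^ 3 * αc L ≤ 1 := fun L hL => by
    have hL0 : (0 : ℝ) < L := by exact_mod_cast lt_trans zero_lt_one hL
    have hpos : (0 : ℝ) < 13 * 10 ^ 14 * (L : ℝ) ^ 3 := by positivity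
    calc 13 * 10 ^ 14 * (L : ℝ) ^ 3 * αc L ≤ 13 * 10 ^ 14 * (L : ℝ) ^ 3 * (13 * 10 ^ 14 * (L : ℝ) ^ 3)⁻¹ := mul_le_mul_of_nonneg_left (hc13 L) hpos.le
      _ = 1 := mul_inv_cancel₀ hpos.ne'
  refine ⟨αc, fun L => γLOD L / 2, hαc0, fun L hL => (mul_le_mul_of_nonneg_left (hcT L) (by positivity)).trans (hWT12 L hL), hW13, fun L _ => hcT L,
    fun L hL => half_pos (hγL L hL), ?_⟩
  intro L hL i U₀ ρ hreg hρ hlift hroom a ha₀a ha₁a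
  have hFL : (i.1.1.L : ℝ) = (L : ℝ) := by rw [i.2.1]
  have hc₀L : 0 < c₀ L := (hc₀ L).out
  have hcBL : 0 < cB L := (hcB L).out
  have hL0 : (0 : ℝ) < L := by exact_mod_cast lt_trans zero_lt_one hL
  have hαcL := hαc0 L hL
  have hMTL := hMT L hL
  have hγLL := hγL L hL
  have ha : 0 ≤ a := le_trans (by positivity) ha₀a
  have hWεc : 10 ^ 12 * (i.1.1.L : ℝ) ^ 3 * αc L ≤ 1 := by
    rw [hFL]; exact (mul_le_mul_of_nonneg_left (hcT L) (by positivity)).trans (hWT12 L hL)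
  have hWεL : 10 ^ 12 * (i.1.1.L : ℝ) ^ 3 * αLOD L ≤ 1 := by rw [hFL]; exact hWαL L hL
  have hW13ρ : 13 * 10 ^ 14 * (i.1.1.L : ℝ) ^ 3 * ρ ≤ 1 := by
    rw [hFL]; exact (mul_le_mul_of_nonneg_left hρ (by positivity)).trans (hW13 L hL)
  have hregc : RegPr i.1.1 i.1.2.1 i.1.2.2 (αc L) U₀ := regPr_mono (F := i.1.1) hρ hreg
  have hregL : RegPr i.1.1 i.1.2.1 i.1.2.2 (αLOD L) U₀ := regPr_mono (F := i.1.1) (hρ.trans (hcLOD L)) hreg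
  -- the τ-row and the form lower bound `re⟪v, T_Jᴾ v⟫ ≥ −τ‖v‖²`
  have hrow := hTsup L hL i U₀ ρ hreg (hρ.trans (hcT L)) hlift hroom a ha₀a ha₁a (αc L) hαcL.le (hcT L) hregc
  have hτ := tauRow_TJP_of_supRow i.1.1 i.2.2.le hαcL hWεc ha U₀ hregc (mul_nonneg hαcL.le hMTL) hrow
  have hτle : αc L * MT L ≤ γLOD L / 2 := by
    have h1 : αc L * MT L ≤ γLOD L / (2 * MT L + 1) * MT L := mul_le_mul_of_nonneg_right (hcγ L) hMTL
    have h2 : γLOD L / (2 * MT L + 1) * MT L ≤ γLOD L / 2 := by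
      rw [div_mul_eq_mul_div, div_le_div_iff₀ (by positivity) (by norm_num)]
      nlinarith
    exact h1.trans h2
  have hTτ : ∀ v : BondL2K ℂ 3 (periodsT3 i.1.1 i.1.2.2) (c₀ L) W₂,
      -(αc L * MT L) * ‖v‖ ^ 2 ≤ RCLike.re ⟪v, TJSlotP i.1.1 i.1.2.1 i.1.2.2 i.2.2.le (c₀ L) (cB L) a U₀ v⟫_ℂ := by
    intro v
    have h1 := hτ v v
    have h2 := RCLike.re_le_norm (K := ℂ) (-⟪v, TJSlotP i.1.1 i.1.2.1 i.1.2.2 i.2.2.le (c₀ L) (cB L) a U₀ v⟫_ℂ)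
    rw [map_neg, norm_neg] at h2
    nlinarith [h1, h2]
  -- ✓`coercive_laplaceA_add_of_curvedTarget_of_lift` at `Δx := Δ^η + T_Jᴾ`
  have hco0 := coercive_laplaceA_add_of_curvedTarget_of_lift (F := i.1.1) i.2.2.le (cB L) (hαL L hL) hWεL U₀ hregL ha₀a
    (DeltaEtaSlot i.1.1 i.1.2.1 i.1.2.2 (c₀ L) + TJSlotP i.1.1 i.1.2.1 i.1.2.2 i.2.2.le (c₀ L) (cB L) a)
    (TJSlotP i.1.1 i.1.2.1 i.1.2.2 i.2.2.le (c₀ L) (cB L) a)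
    (fun v => by rw [Pi.add_apply, LinearMap.add_apply, DeltaEtaSlot_apply]) hTτ (hT L hL i U₀ hregL) hlift
  have hco' : ∀ x : BondL2K ℂ 3 (periodsT3 i.1.1 i.1.2.2) (c₀ L) W₂,
      γLOD L / 2 * ‖x‖ ^ 2 ≤ RCLike.re ⟪x, laplaceA i.1.1 i.1.2.1 i.1.2.2 i.2.2.le (c₀ L) (cB L) a
        (DeltaEtaSlot i.1.1 i.1.2.1 i.1.2.2 (c₀ L) + TJSlotP i.1.1 i.1.2.1 i.1.2.2 i.2.2.le (c₀ L) (cB L) a) U₀ x⟫_ℂ := fun x => by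
    have h1 := hco0 x
    have h2 : γLOD L / 2 * ‖x‖ ^ 2 ≤ (γLOD L - αc L * MT L) * ‖x‖ ^ 2 := mul_le_mul_of_nonneg_right (by linarith) (sq_nonneg _)
    exact h2.trans h1
  exact ⟨hco', posOnto_of_coercive i.2.2.le (cB L) i.2.2 hreg hW13ρ (half_pos hγLL) _ hco', norm_GT_le_of_coercive i.2.2.le (cB L) i.2.2 hreg hW13ρ (half_pos hγLL) _ hco'⟩

/-- ★★ **THE SAME THREE ROWS AT `DeltaOnePJ … a` (the slot of S47's `norm_G`; ✓`DeltaOnePJ_def`: `DeltaOnePJ = DeltaOneP … (TJSlotP …)` by `rfl`).**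
[cite: Balaban1985BackgroundPropagators, Thm 3.11 p.416, (3.127)–(3.128) p.421] -/
theorem hco_DeltaOnePJ_exists_of_tjSupLin' (c₀ cB : ℕ → ℝ) [hc₀ : ∀ L : ℕ, Fact (0 < c₀ L)] [hcB : ∀ L : ℕ, Fact (0 < cB L)] {a₀ a₁ : ℝ} (ha₀ : 0 < a₀)
    (αT MT : ℕ → ℝ) (hαT : ∀ L : ℕ, 1 < L → 0 < αT L) (hWT12 : ∀ L : ℕ, 1 < L → 10 ^ 12 * (L : ℝ) ^ 3 * αT L ≤ 1) (hMT : ∀ L : ℕ, 1 < L → 0 ≤ MT L)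
    (hTsup : ∀ (L : ℕ), 1 < L → ∀ (i : Idx L) (U₀ : GaugeField (i.1.1.P i.1.2.2) 0 (Matrix.specialUnitaryGroup (Fin 2) ℂ)), ∀ ρ : ℝ, RegPr i.1.1 i.1.2.1 i.1.2.2 ρ U₀ → ρ ≤ αT L →
        (∀ cf : Site (i.1.1.P i.1.2.2) (i.1.2.2 - i.1.2.1) → Matrix (Fin 2) (Fin 2) ℂ,
        (∀ e' : PBond (i.1.1.P i.1.2.2) (i.1.2.2 - i.1.2.1), cf e'.src = ((emlIterU (i.1.2.2 - i.1.2.1) (bgUnits i.1.1 i.1.2.2 U₀) e' : (Matrix (Fin 2) (Fin 2) ℂ)ˣ) : Matrix (Fin 2) (Fin 2) ℂ) * cf e'.tgt *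
        (((emlIterU (i.1.2.2 - i.1.2.1) (bgUnits i.1.1 i.1.2.2 U₀) e')⁻¹ : (Matrix (Fin 2) (Fin 2) ℂ)ˣ) : Matrix (Fin 2) (Fin 2) ℂ)) →
        ∃ l₀ : Site (i.1.1.P i.1.2.2) 0 → Matrix (Fin 2) (Fin 2) ℂ,
        (∀ b' : PBond (i.1.1.P i.1.2.2) 0, l₀ b'.src = ((bgUnits i.1.1 i.1.2.2 U₀ b' : (Matrix (Fin 2) (Fin 2) ℂ)ˣ) : Matrix (Fin 2) (Fin 2) ℂ) * l₀ b'.tgt * (((bgUnits i.1.1 i.1.2.2 U₀ b')⁻¹ : (Matrix (Fin 2) (Fin 2) ℂ)ˣ) : Matrix (Fin 2) (Fin 2) ℂ)) ∧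
        ∀ y : Site (i.1.1.P i.1.2.2) (i.1.2.2 - i.1.2.1), l₀ (embIter (i.1.2.2 - i.1.2.1) y) = cf y) →
      2 * (12 * i.1.1.L ^ (i.1.2.2 - i.1.2.1) + 5) ≤ (i.1.1.P i.1.2.2).sitesPerDir 0 →
      ∀ a : ℝ, a₀ * (c₀ L / cB L) * ((i.1.1.L : ℝ) ^ (i.1.2.2 - i.1.2.1)) ^ 3 ≤ a → a ≤ a₁ * (c₀ L / cB L) * ((i.1.1.L : ℝ) ^ (i.1.2.2 - i.1.2.1)) ^ 3 →
      ∀ ρ' : ℝ, 0 ≤ ρ' → ρ' ≤ αT L → RegPr i.1.1 i.1.2.1 i.1.2.2 ρ' U₀ →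
        ∀ (X : PBond (i.1.1.P i.1.2.2) 0 → Matrix (Fin 2) (Fin 2) ℂ) (s : ℝ), (∀ bd, ‖X bd‖ ≤ s) →
          ∀ bd : PBond (i.1.1.P i.1.2.2) 0, ‖(toL2 i.1.1 i.1.2.2 (c₀ L)).symm (TJSlotP i.1.1 i.1.2.1 i.1.2.2 i.2.2.le (c₀ L) (cB L) a U₀ (toL2 i.1.1 i.1.2.2 (c₀ L) X)) bd‖
            ≤ (ρ' * MT L) * s) :
    ∃ (αc γc : ℕ → ℝ),
      (∀ L : ℕ, 1 < L → 0 < αc L) ∧ (∀ L : ℕ, 1 < L → 10 ^ 12 * (L : ℝ) ^ 3 * αc L ≤ 1) ∧ (∀ L : ℕ, 1 < L → 13 * 10 ^ 14 * (L : ℝ) ^ 3 * αc L ≤ 1) ∧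
      (∀ L : ℕ, 1 < L → αc L ≤ αT L) ∧ (∀ L : ℕ, 1 < L → 0 < γc L) ∧
    ∀ (L : ℕ), 1 < L → ∀ (i : Idx L) (U₀ : GaugeField (i.1.1.P i.1.2.2) 0 (Matrix.specialUnitaryGroup (Fin 2) ℂ)), ∀ ρ : ℝ, RegPr i.1.1 i.1.2.1 i.1.2.2 ρ U₀ → ρ ≤ αc L →
        (∀ cf : Site (i.1.1.P i.1.2.2) (i.1.2.2 - i.1.2.1) → Matrix (Fin 2) (Fin 2) ℂ,
        (∀ e' : PBond (i.1.1.P i.1.2.2) (i.1.2.2 - i.1.2.1), cf e'.src = ((emlIterU (i.1.2.2 - i.1.2.1) (bgUnits i.1.1 i.1.2.2 U₀) e' : (Matrix (Fin 2) (Fin 2) ℂ)ˣ) : Matrix (Fin 2) (Fin 2) ℂ) * cf e'.tgt *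
        (((emlIterU (i.1.2.2 - i.1.2.1) (bgUnits i.1.1 i.1.2.2 U₀) e')⁻¹ : (Matrix (Fin 2) (Fin 2) ℂ)ˣ) : Matrix (Fin 2) (Fin 2) ℂ)) →
        ∃ l₀ : Site (i.1.1.P i.1.2.2) 0 → Matrix (Fin 2) (Fin 2) ℂ,
        (∀ b' : PBond (i.1.1.P i.1.2.2) 0, l₀ b'.src = ((bgUnits i.1.1 i.1.2.2 U₀ b' : (Matrix (Fin 2) (Fin 2) ℂ)ˣ) : Matrix (Fin 2) (Fin 2) ℂ) * l₀ b'.tgt * (((bgUnits i.1.1 i.1.2.2 U₀ b')⁻¹ : (Matrix (Fin 2) (Fin 2) ℂ)ˣ) : Matrix (Fin 2) (Fin 2) ℂ)) ∧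
        ∀ y : Site (i.1.1.P i.1.2.2) (i.1.2.2 - i.1.2.1), l₀ (embIter (i.1.2.2 - i.1.2.1) y) = cf y) →
      2 * (12 * i.1.1.L ^ (i.1.2.2 - i.1.2.1) + 5) ≤ (i.1.1.P i.1.2.2).sitesPerDir 0 →
      ∀ a : ℝ, a₀ * (c₀ L / cB L) * ((i.1.1.L : ℝ) ^ (i.1.2.2 - i.1.2.1)) ^ 3 ≤ a → a ≤ a₁ * (c₀ L / cB L) * ((i.1.1.L : ℝ) ^ (i.1.2.2 - i.1.2.1)) ^ 3 →
      (∀ x : BondL2K ℂ 3 (periodsT3 i.1.1 i.1.2.2) (c₀ L) W₂,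
        γc L * ‖x‖ ^ 2 ≤ RCLike.re ⟪x, laplaceA i.1.1 i.1.2.1 i.1.2.2 i.2.2.le (c₀ L) (cB L) a (DeltaOnePJ i.1.1 i.1.2.1 i.1.2.2 i.2.2.le (c₀ L) (cB L) a) U₀ x⟫_ℂ) ∧
      PosOnto i.1.1 i.1.2.1 i.1.2.2 i.2.2.le (c₀ L) (cB L) a (DeltaOnePJ i.1.1 i.1.2.1 i.1.2.2 i.2.2.le (c₀ L) (cB L) a) U₀ ∧
      (∀ f : BondL2K ℂ 3 (periodsT3 i.1.1 i.1.2.2) (c₀ L) W₂,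
        ‖GT i.1.1 i.1.2.1 i.1.2.2 i.2.2.le (c₀ L) (cB L) a (DeltaOnePJ i.1.1 i.1.2.1 i.1.2.2 i.2.2.le (c₀ L) (cB L) a) U₀ f‖ ≤ (γc L)⁻¹ * ‖f‖) :=
  hco_DeltaOnePJ_exists_of_tjSupLin c₀ cB ha₀ αT MT hαT hWT12 hMT hTsup

end Summit.QuantumFields.YangMills.Theorems.Prop7CoerciveDeltaOnePJOfTJSupRow

end
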